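import Mathlib
import HarnessLib
import Summits.Ventures.LatticeQCDFlow.Scaling.AutoregressiveGaugeHeatBathRanked
import Summits.Ventures.LatticeQCDFlow.Scaling.TorusTopLinkComb

/-!
# LatticeQCDFlow / Scaling — the comb sampler: an implementable one-plaquette heat-bath autoregressive model
# draws EXACTLY from the all-but-one-plaquette law of `(ℤ/L)²`

HONEST FRAMING: exact (Metropolis-corrected) sampling algorithms for lattice gauge theory;
figures of merit are autocorrelation/cost numbers at stated couplings and volumes; no
continuum-physics claim.

Venture `LatticeQCDFlow` (cell pub-lqcd), topic `Scaling`, FANOUT row 30 (lean-1, GEN-24) — OUR WORK on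
THEORY-2.md §4 row C5; sequel to `Scaling/AutoregressiveGaugeHeatBathRanked` (heat-bath exactness on every
RANKED plaquette collection) and `Scaling/TorusTopLinkComb` (the comb).  THE COMB of `(ℤ/L)²`, made
explicit: `t x = (x + e₁, 0)` off the last row `x₁ = −1`, `t x = (x + e₀, 1)` on it, rank `x₁.val`,
resp. `L + x₀.val`.  It is injective (`comb_injective`), picks a link of each plaquette (`comb_mem_links`)
and is ranked on `B` = all plaquettes but the corner `q₀ = ((−1,−1); 0, 1)` (`comb_rank_lt`).  Hence:
`Z_B = c^{L²−1}` (`integral_prod_weight_comb_eq_pow`); a compatible generation order of all `2L²` links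
exists (`exists_comb_compatible_order`, via `PlaquetteTopLinkOrders` §4); and the one-plaquette heat-bath
autoregressive model along the comb — conditioner `w(U_p)/c` at `t p` for `p ∈ B`, `1` elsewhere; each
normalised in its own link, reading only the plaquette it closes, squeezed (the ranked file) — is EXACT
for the block law: `(∏_{b∈l} q_b)·A_l F_B/Z_B = F_B/Z_B` for every duplicate-free list `l` of all links
(`comb_arHybrid_eq_target`).  In the base-site language of `Scaling/AutoregressiveGaugeHeatBathTorusTauInt`
(`prod_comb_eq_prod_site`, `card_univ_sdiff_erase`) that law is the proposal `q = (F_B/Z_B)·Haar^{⊗E}` of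
`hbProposal_autocorrelation` with `B = univ.erase (−1,−1)` and `k = #Bᶜ = 1`: the exact independence
Metropolis sampler it drives for the periodic target `∏_{all x} w(U_x)` has `τ_int(f) ≤ M/m − 1/2` for
every bounded observable `f`, AT EVERY VOLUME `L ≥ 2` — against the perimeter law `(M/m)^{2L−1} − 1/2` of
the rectangle proposal and the area-law floors of endpoint-blind models.

No `def`, no `sorry`, nothing cited as a fact beyond the tree.
-/

noncomputable section

namespace Summit.Ventures.LatticeQCDFlow.Theory2.Autoregressive

open MeasureTheory Function Finset
open Literature.MathematicalPhysics.QuantumFieldTheory Literature.MathematicalPhysics.QuantumLattice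
open Summit.Ventures.LatticeQCDFlow.Exactness

/-! ## §0 Causality along a compatible order (every dimension) -/

section Causal

variable {d L : ℕ} {G : Type*} [Group G]

/-- **Causality**: if every plaquette of `B` is good along the list `l` (each of its links other than `t p`
strictly before `t p` in `l`), then the conditioner at `b` ignores every link generated AFTER `b`:
`q_b(U[e ↦ v]) = q_b(U)` whenever `l.idxOf b < l.idxOf e` — together with normalisation in `b`
(`rankedHeatBath_integral_update_eq_one`) this is what makes `∏_b q_b` a genuine autoregressive
(ancestral-sampling) model along `l`. [ours] -/
theorem rankedHeatBath_update_of_idxOf_lt {w : G → ℝ} (c : ℝ) (B : Finset (Plaquette d L))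
    (t : Plaquette d L → Edge d L) (l : List (Edge d L))
    (hgood : ∀ p ∈ B, ∀ e' ∈ ({(p.1, p.2.1.1), (p.1.shift p.2.1.1, p.2.1.2),
        (p.1.shift p.2.1.2, p.2.1.1), (p.1, p.2.1.2)} : Finset (Edge d L)), e' ≠ t p →
      l.idxOf e' < l.idxOf (t p))
    {b e : Edge d L} (hbe : l.idxOf b < l.idxOf e) (U : GaugeConfig d L G) (v : G) :
    ∏ p ∈ B.filter (fun p' => t p' = b), w (plaquetteHolonomy (update U e v) p.1 p.2.1.1 p.2.1.2) / c =
      ∏ p ∈ B.filter (fun p' => t p' = b), w (plaquetteHolonomy U p.1 p.2.1.1 p.2.1.2) / c := by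
  classical
  refine rankedHeatBath_update_of_forall_ne c B t b e (fun p hp hpb => ?_) U v
  -- every link `e'` of `p` has `l.idxOf e' ≤ l.idxOf (t p) = l.idxOf b < l.idxOf e`, so `e' ≠ e`
  have hlt : ∀ e' ∈ ({(p.1, p.2.1.1), (p.1.shift p.2.1.1, p.2.1.2),
      (p.1.shift p.2.1.2, p.2.1.1), (p.1, p.2.1.2)} : Finset (Edge d L)), e' ≠ e := by
    intro e' he' hee
    by_cases h : e' = t p
    · rw [hee, hpb] at h; rw [h] at hbe; exact lt_irrefl _ hbe
    · have h1 := hgood p hp e' he' h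
      rw [hpb, hee] at h1
      exact lt_irrefl _ (h1.trans hbe)
  exact ⟨hlt _ (by simp), hlt _ (by simp), hlt _ (by simp), hlt _ (by simp)⟩

end Causal

section Comb

variable {L : ℕ} [NeZero L]

omit [NeZero L] in
/-- The comb assignment is injective: `t x = (x + e₀, 1)` on the last row `x₁ = −1`, `(x + e₁, 0)`
elsewhere. [ours] -/
theorem comb_injective :
    Function.Injective (fun p : Plaquette 2 L =>
      (if p.1 1 = -1 then (p.1.shift 0, (1 : Fin 2)) else (p.1.shift 1, (0 : Fin 2)) : Edge 2 L)) := by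
  have hshift_inj : ∀ (x y : Site 2 L) (i : Fin 2), x.shift i = y.shift i → x = y := by
    intro x y i h; simpa [Site.shift] using h
  intro p p' h
  obtain ⟨x, q⟩ := p
  obtain ⟨x', q'⟩ := p'
  have hq := Theory2.Lattice.TwoDim.plane_eq_zero_one q
  have hq' := Theory2.Lattice.TwoDim.plane_eq_zero_one q'
  subst hq; subst hq'
  simp only at h
  split_ifs at h with h1 h2 h2
  · exact Prod.ext (hshift_inj x x' 0 (congrArg Prod.fst h)) rfl
  · have h2 : (1 : Fin 2) = 0 := congrArg Prod.snd h
    exact absurd h2 (by decide)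
  · have h2 : (0 : Fin 2) = 1 := congrArg Prod.snd h
    exact absurd h2 (by decide)
  · exact Prod.ext (hshift_inj x x' 1 (congrArg Prod.fst h)) rfl

omit [NeZero L] in
/-- The comb assigns to every plaquette one of its own four links. [ours] -/
theorem comb_mem_links (p : Plaquette 2 L) :
    (if p.1 1 = -1 then (p.1.shift 0, (1 : Fin 2)) else (p.1.shift 1, (0 : Fin 2)) : Edge 2 L) ∈
      ({(p.1, p.2.1.1), (p.1.shift p.2.1.1, p.2.1.2), (p.1.shift p.2.1.2, p.2.1.1), (p.1, p.2.1.2)} :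
        Finset (Edge 2 L)) := by
  obtain ⟨x, q⟩ := p
  have hq := Theory2.Lattice.TwoDim.plane_eq_zero_one q
  subst hq
  split_ifs <;> simp

/-- **The comb is ranked on all plaquettes but the corner `q₀ = ((−1,−1); 0, 1)`**: with rank `x₁.val`
off the last row and `L + x₀.val` on it, `rank p < rank p'` whenever `p ≠ p'` are both `≠ q₀` and the
comb link of `p` lies on `p'` (`L ≥ 2`). [ours] -/
theorem comb_rank_lt (hL : 2 ≤ L) :
    ∀ p ∈ (Finset.univ.erase (((![-1, -1] : Site 2 L), ⟨((0 : Fin 2), (1 : Fin 2)), by decide⟩) :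
        Plaquette 2 L)),
      ∀ p' ∈ (Finset.univ.erase (((![-1, -1] : Site 2 L), ⟨((0 : Fin 2), (1 : Fin 2)), by decide⟩) :
        Plaquette 2 L)), p ≠ p' →
      (if p.1 1 = -1 then (p.1.shift 0, (1 : Fin 2)) else (p.1.shift 1, (0 : Fin 2)) : Edge 2 L) ∈
        ({(p'.1, p'.2.1.1), (p'.1.shift p'.2.1.1, p'.2.1.2), (p'.1.shift p'.2.1.2, p'.2.1.1),
          (p'.1, p'.2.1.2)} : Finset (Edge 2 L)) →
      (fun r : Plaquette 2 L => if r.1 1 = -1 then L + (r.1 0).val else (r.1 1).val) p <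
        (fun r : Plaquette 2 L => if r.1 1 = -1 then L + (r.1 0).val else (r.1 1).val) p' := by
  haveI : Fact (1 < L) := ⟨hL⟩
  have hshift_inj : ∀ (x y : Site 2 L) (i : Fin 2), x.shift i = y.shift i → x = y := by
    intro x y i h; simpa [Site.shift] using h
  have hs0_1 : ∀ x : Site 2 L, (x.shift 0) 1 = x 1 := fun x => by simp [Site.shift]
  have hs0_0 : ∀ x : Site 2 L, (x.shift 0) 0 = x 0 + 1 := fun x => by simp [Site.shift]
  have hs1_1 : ∀ x : Site 2 L, (x.shift 1) 1 = x 1 + 1 := fun x => by simp [Site.shift]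
  intro p hp p' hp' hne hmem
  obtain ⟨x, q⟩ := p
  obtain ⟨x', q'⟩ := p'
  have hq := Theory2.Lattice.TwoDim.plane_eq_zero_one q
  have hq' := Theory2.Lattice.TwoDim.plane_eq_zero_one q'
  subst hq; subst hq'
  simp only [Finset.mem_insert, Finset.mem_singleton] at hmem
  by_cases hrow : x 1 = -1
  · -- last row: `t p = (x + e₀, 1)` is the left link of the plaquette to the right
    rw [if_pos hrow] at hmem
    simp only [hrow, if_true]
    rcases hmem with h | h | h | h
    · have h2 : (1 : Fin 2) = 0 := congrArg Prod.snd h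
      exact absurd h2 (by decide)
    · exact (hne (Prod.ext (hshift_inj x x' 0 (congrArg Prod.fst h)) rfl)).elim
    · have h2 : (1 : Fin 2) = 0 := congrArg Prod.snd h
      exact absurd h2 (by decide)
    · have hx' : x' = x.shift 0 := (congrArg Prod.fst h).symm
      have hx0 : x 0 ≠ -1 := by
        intro h0
        apply Finset.ne_of_mem_erase hp
        refine Prod.ext ?_ rfl
        ext k; fin_cases k
        · simpa using h0
        · simpa using hrow
      have hrow' : x' 1 = -1 := by rw [hx', hs0_1, hrow]
      rw [if_pos hrow', hx', hs0_0, val_add_one_of_ne_neg_one hL hx0]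
      omega
  · -- other rows: `t p = (x + e₁, 0)` is the bottom link of the plaquette above
    rw [if_neg hrow] at hmem
    simp only [hrow, if_false]
    rcases hmem with h | h | h | h
    · have hx' : x' = x.shift 1 := (congrArg Prod.fst h).symm
      have hval : (x' 1).val = (x 1).val + 1 := by
        rw [hx', hs1_1, val_add_one_of_ne_neg_one hL hrow]
      by_cases hrow' : x' 1 = -1
      · simp only [hrow', if_true]
        have := ZMod.val_lt (x 1); omega
      · simp only [hrow', if_false]
        omega
    · have h2 : (0 : Fin 2) = 1 := congrArg Prod.snd h
      exact absurd h2 (by decide)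
    · exact (hne (Prod.ext (hshift_inj x x' 1 (congrArg Prod.fst h)) rfl)).elim
    · have h2 : (0 : Fin 2) = 1 := congrArg Prod.snd h
      exact absurd h2 (by decide)

/-- `(ℤ/L)²` has `L²` plaquettes, so all but the corner are `L² − 1`. [ours] -/
theorem card_univ_erase_plaquette_two (q₀ : Plaquette 2 L) :
    (Finset.univ.erase q₀).card = L ^ 2 - 1 := by
  rw [Finset.card_erase_of_mem (Finset.mem_univ _), Finset.card_univ, Fintype.card_prod,
    Fintype.card_fun, ZMod.card, Fintype.card_fin,
    Fintype.card_eq_one_iff.2 ⟨⟨((0 : Fin 2), (1 : Fin 2)), by decide⟩,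
      fun p => Theory2.Lattice.TwoDim.plane_eq_zero_one p⟩, mul_one]

/-- **A compatible generation order for the comb**: a duplicate-free list of ALL `2L²` links in which every
plaquette `p ≠ q₀` has its three links other than its comb link strictly before the comb link
(`PlaquetteTopLinkOrders.exists_order_of_topLink_rank` with the comb rank). [ours] -/
theorem exists_comb_compatible_order (hL : 2 ≤ L) :
    ∃ l : List (Edge 2 L), l.Nodup ∧ (∀ e : Edge 2 L, e ∈ l) ∧
      ∀ p ∈ (Finset.univ.erase (((![-1, -1] : Site 2 L), ⟨((0 : Fin 2), (1 : Fin 2)), by decide⟩) :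
          Plaquette 2 L)),
        ∀ e' ∈ ({(p.1, p.2.1.1), (p.1.shift p.2.1.1, p.2.1.2), (p.1.shift p.2.1.2, p.2.1.1),
            (p.1, p.2.1.2)} : Finset (Edge 2 L)),
          e' ≠ (if p.1 1 = -1 then (p.1.shift 0, (1 : Fin 2)) else (p.1.shift 1, (0 : Fin 2))) →
            l.idxOf e' <
              l.idxOf (if p.1 1 = -1 then (p.1.shift 0, (1 : Fin 2)) else (p.1.shift 1, (0 : Fin 2))) :=
  exists_order_of_topLink_rank _ _ comb_injective.injOn _ (comb_rank_lt hL)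

variable {G : Type*} [Group G] [TopologicalSpace G] [IsTopologicalGroup G]
  [CompactSpace G] [SecondCountableTopology G] [MeasurableSpace G] [BorelSpace G]

/-- **`Z_B = c^{L²−1}` for the comb collection** `B = all plaquettes of (ℤ/L)² but q₀` (`L ≥ 2`,
`w` continuous with `0 < m ≤ w ≤ M`). [ours] -/
theorem integral_prod_weight_comb_eq_pow (hL : 2 ≤ L) {w : G → ℝ} (hw : Continuous w) {m M : ℝ}
    (hm0 : 0 < m) (hm : ∀ g, m ≤ w g) (hM : ∀ g, w g ≤ M) :
    ∫ U, ∏ p ∈ (Finset.univ.erase (((![-1, -1] : Site 2 L), ⟨((0 : Fin 2), (1 : Fin 2)), by decide⟩) :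
          Plaquette 2 L)), w (plaquetteHolonomy U p.1 p.2.1.1 p.2.1.2)
        ∂(Measure.pi fun _ : Edge 2 L => haarProbability G) =
      (∫ g, w g ∂(haarProbability G)) ^ (L ^ 2 - 1) := by
  rw [integral_prod_weight_eq_pow_of_rank hL hw hm0 hm hM _ _ (fun p _ => comb_mem_links p) _
    (comb_rank_lt hL), card_univ_erase_plaquette_two]

/-- **THE COMB SAMPLER IS EXACT.**  `L ≥ 2`, `w` continuous with `0 < m ≤ w ≤ M`, `B` = all plaquettes of
`(ℤ/L)²` but `q₀`, comb conditioners `q_b(U) = ∏_{p∈B, t p = b} w(U_p)/c`: for every duplicate-free list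
`l` of ALL links, `(∏_{b∈l} q_b(U))·A_l F_B(U)/Z_B = F_B(U)/Z_B`.  With `exists_comb_compatible_order`,
`rankedHeatBath_integral_update_eq_one` (normalisation, `comb_injective`), `rankedHeatBath_update_of_forall_ne`
(each `q_b` reads only the plaquette it closes) and `rankedHeatBath_squeezed`: the one-plaquette heat-bath
autoregressive model along the comb is an implementable ancestral sampler drawing EXACTLY from
`(F_B/Z_B)·Haar^{⊗E}`. [ours] -/
theorem comb_arHybrid_eq_target (hL : 2 ≤ L) {w : G → ℝ} (hw : Continuous w) {m M : ℝ}
    (hm0 : 0 < m) (hm : ∀ g, m ≤ w g) (hM : ∀ g, w g ≤ M)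
    (l : List (Edge 2 L)) (hl : l.Nodup) (hall : ∀ e : Edge 2 L, e ∈ l) (U : GaugeConfig 2 L G) :
    (l.map fun b => ∏ p ∈ (Finset.univ.erase (((![-1, -1] : Site 2 L),
        ⟨((0 : Fin 2), (1 : Fin 2)), by decide⟩) : Plaquette 2 L)).filter
          (fun p' => (if p'.1 1 = -1 then (p'.1.shift 0, (1 : Fin 2)) else (p'.1.shift 1, (0 : Fin 2))) = b),
        w (plaquetteHolonomy U p.1 p.2.1.1 p.2.1.2) / (∫ g, w g ∂(haarProbability G))).prod *
        coordAvg (haarProbability G) l.toFinset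
          (fun V : GaugeConfig 2 L G => ∏ p ∈ (Finset.univ.erase (((![-1, -1] : Site 2 L),
            ⟨((0 : Fin 2), (1 : Fin 2)), by decide⟩) : Plaquette 2 L)),
              w (plaquetteHolonomy V p.1 p.2.1.1 p.2.1.2)) U /
        (∫ V, ∏ p ∈ (Finset.univ.erase (((![-1, -1] : Site 2 L),
            ⟨((0 : Fin 2), (1 : Fin 2)), by decide⟩) : Plaquette 2 L)),
              w (plaquetteHolonomy V p.1 p.2.1.1 p.2.1.2)
          ∂(Measure.pi fun _ : Edge 2 L => haarProbability G)) =
      (∏ p ∈ (Finset.univ.erase (((![-1, -1] : Site 2 L),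
          ⟨((0 : Fin 2), (1 : Fin 2)), by decide⟩) : Plaquette 2 L)),
            w (plaquetteHolonomy U p.1 p.2.1.1 p.2.1.2)) /
        (∫ V, ∏ p ∈ (Finset.univ.erase (((![-1, -1] : Site 2 L),
            ⟨((0 : Fin 2), (1 : Fin 2)), by decide⟩) : Plaquette 2 L)),
              w (plaquetteHolonomy V p.1 p.2.1.1 p.2.1.2)
          ∂(Measure.pi fun _ : Edge 2 L => haarProbability G)) :=
  ranked_arHybrid_eq_target hL hw hm0 hm hM _ _ (fun p _ => comb_mem_links p) _ (comb_rank_lt hL)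
    l hl hall U

omit [TopologicalSpace G] [IsTopologicalGroup G] [CompactSpace G] [SecondCountableTopology G]
  [MeasurableSpace G] [BorelSpace G] in
/-- **The comb block weight in the base-site language** of `Scaling/AutoregressiveGaugeHeatBathTorusTauInt`:
`∏_{p ∈ B} w(U_p) = ∏_{x ≠ (−1,−1)} w(U_{x;0,1})` — so `(F_B/Z_B)·Haar^{⊗E}` is the proposal law `q` of
`hbProposal_autocorrelation` with `B = univ.erase (−1,−1)`, `k = #Bᶜ = 1`: the exact independence
Metropolis sampler it drives for the periodic target has `τ_int(f) ≤ M/m − 1/2` for every bounded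
observable, at every volume `L ≥ 2`. [ours] -/
theorem prod_comb_eq_prod_site (w : G → ℝ) (U : GaugeConfig 2 L G) :
    ∏ p ∈ (Finset.univ.erase (((![-1, -1] : Site 2 L), ⟨((0 : Fin 2), (1 : Fin 2)), by decide⟩) :
        Plaquette 2 L)), w (plaquetteHolonomy U p.1 p.2.1.1 p.2.1.2) =
      ∏ x ∈ Finset.univ.erase (![-1, -1] : Site 2 L), w (plaquetteHolonomy U x 0 1) := by
  refine Finset.prod_equiv
    ({ toFun := fun p => p.1
       invFun := fun x => (x, ⟨((0 : Fin 2), (1 : Fin 2)), by decide⟩)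
       left_inv := fun p => Prod.ext rfl (Theory2.Lattice.TwoDim.plane_eq_zero_one p.2).symm
       right_inv := fun _ => rfl } : Plaquette 2 L ≃ Site 2 L) (fun p => ?_) (fun p _ => ?_)
  · obtain ⟨x, q⟩ := p
    have hq := Theory2.Lattice.TwoDim.plane_eq_zero_one q
    subst hq
    simp only [Finset.mem_erase, Finset.mem_univ, and_true, Equiv.coe_fn_mk, ne_eq, Prod.mk.injEq]
  · obtain ⟨x, q⟩ := p
    have hq := Theory2.Lattice.TwoDim.plane_eq_zero_one q
    subst hq
    rfl

/-- `#(univ \ univ.erase x₀) = 1`: the comb leaves exactly one plaquette outside. [ours] -/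
theorem card_univ_sdiff_erase {α : Type*} [Fintype α] [DecidableEq α] (x₀ : α) :
    (Finset.univ \ Finset.univ.erase x₀).card = 1 := by
  rw [Finset.sdiff_erase (Finset.mem_univ x₀), Finset.sdiff_self]
  simp

end Comb

end Summit.Ventures.LatticeQCDFlow.Theory2.Autoregressive

end
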